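import Summits.ABC.ABC.Theorems.TwistAmplificationSharpModerateLawCuspSumBound23Lemmas

/-!
# Crux `TwistAmplification.SharpModerateLaw` (stmt-ABC-1975), stub `stub_cuspStationaryPhase23` — file 2/2:
the prime `p = 2` and the registered stub

Line `deep-moduli-cusp-dispersion`, registered stub `stub_cuspStationaryPhase23` (statement `CuspSumBound23` of
`…CuspDispersionTwDefs.lean`): the stationary-phase bound `|S(h₁,h₂;pⁿ)| ≤ 2·p^{n/2}` for the complete cusp sums
`S(h₁,h₂;pⁿ) = Σ_{t ∈ (ℤ/pⁿ)ˣ} e((h₁t² + h₂t³)/pⁿ)` at the two small primes `p ∈ {2, 3}`, `n ≥ 2`, `(h₁,h₂)` not both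
divisible by `p`. The companion file `…CuspSumBound23Lemmas.lean` (1/2) proves the `p = 3` half
(`cuspSumBound23_three_main`); this file proves the `p = 2` half (`norm_cuspSum_two_le`) and assembles the registered
stub (`stub_cuspStationaryPhase23`, verbatim signature). Throughout `e(x/N)` of an integer `x` is
`ZMod.stdAddChar (N := N) (x : ZMod N)`, and the generic machinery of `…DeepModuliStationaryPhase.lean`
(`DeepModuli.cuspSum_firstStep`, orthogonality `sum_range_stdAddChar_mul`, rescaling `stdAddChar_mul_eq`, reindexing
`sum_range_mul_eq_sum_sum`) and of file 1/2 (`card_filter_le_one_of_linear`, `norm_sum_stdAddChar_le_card`,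
`sum_filter_range_mul`, `card_filter_coprime_prime_pow`) is reused.

At `p = 2`, with `f(t) = h₁t² + h₂t³`, `f′(t) = t(2h₁ + 3h₂t)`, no Gauss sum is needed:
* Even `n = 2b` (`norm_cuspSum_two_le`, even branch): the generic first step with `a = b` gives
  `S = 2ᵇ·Σ_{odd y < 2ᵇ, 2ᵇ ∣ 2h₁ + 3h₂y} e(f(y)/2ⁿ)`, and there are at most two such `y`
  (`card_critical_two_even_le_two`: none if `h₂` is odd; if `h₂ = 2h₂′` the condition `2^{b-1} ∣ h₁ + 3h₂′y` with
  `h₁` odd has at most one solution modulo `2^{b-1}`, hence at most two below `2ᵇ`), so `|S| ≤ 2·2^{n/2}`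
  (`n = 2` is the trivial bound `φ(4) = 2`).
* Odd `n = 2a + 1` (`cuspSum_firstStep_two_odd`): substituting `t = y + 2ᵃz` with `z < 2^{a+1}`, the `z²`-term
  `2^{2a}z²(h₁ + 3h₂y)` does NOT vanish modulo `2^{2a+1}` but is linear in disguise, `z² ≡ z (mod 2)`, so
  `f(y + 2ᵃz) ≡ f(y) + 2ᵃ z g(y) (mod 2^{2a+1})` with `g(y) = y(2h₁ + 3h₂y) + 2ᵃ(h₁ + 3h₂y)`, and orthogonality in `z`
  gives `S = 2^{a+1}·Σ_{odd y < 2ᵃ, 2^{a+1} ∣ g(y)} e(f(y)/2ⁿ)`. For odd `y`, `y·(L + Ky) ≡ g(y) (mod 2^{a+1})` with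
  `L = 2h₁ + 3·2ᵃh₂`, `K = 3h₂ + 2ᵃh₁`, so the critical `y` solve a linear congruence with `(L, K)` (or `(L/2, K/2)`
  when `h₂` is even) not both even: at most one critical `y` (`card_critical_two_le_one`), whence
  `|S| ≤ 2^{a+1} = √2·2^{n/2}`.
(Iwaniec–Kowalski 2004, §12.3, "stationary phase for prime powers", adapted to `p = 2`; numerically the bound is attained
with ratio `√2` for all `3 ≤ n ≤ 8`.)
-/

noncomputable section

-- `Summit.<Summit>.<Problem>` is the mandated summit-side namespace (CONVENTIONS §2); for the
-- single-conjunct summit `ABC` the two coincide, so the duplicate `ABC.ABC` is deliberate.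
set_option linter.dupNamespace false

namespace Summit.ABC.ABC.Theorems.SharpModerateLaw.CuspDispersion

open Finset
open Summit.ABC.ABC.Theorems.SharpModerateLaw.DeepModuli

/-! ## A. The prime `p = 2`: counting critical points -/

/-- `z² ≡ z (mod 2)` (Fermat at `p = 2`). [folklore] -/
theorem two_dvd_sq_sub (z : ℕ) : (2 : ℤ) ∣ (z : ℤ) ^ 2 - z := by
  -- adapted from `three_dvd_pow_three_sub` (file 1/2)
  have h := (ZMod.intCast_zmod_eq_zero_iff_dvd ((z : ℤ) ^ 2 - z) 2).mp (by
    push_cast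
    rw [ZMod.pow_card, sub_self])
  exact_mod_cast h

/-- **Even exponent, at most two critical points at `p = 2`.** For `(h₁, h₂)` not both even and `b ≥ 2`, at most
two odd `y < 2ᵇ` satisfy `2ᵇ ∣ 2h₁ + 3h₂y`: none if `h₂` is odd (the form is then odd), and if `h₂ = 2h₂′` (so `h₁`
is odd) the condition reads `2^{b-1} ∣ h₁ + 3h₂′y`, one class modulo `2^{b-1}` (`card_filter_le_one_of_linear`), i.e.
at most two values below `2ᵇ` (the predicate is `2^{b-1}`-periodic, `sum_filter_range_mul`). [folklore] -/
theorem card_critical_two_even_le_two {h₁ h₂ : ℤ} (hnot : ¬ ((2 : ℤ) ∣ h₁ ∧ (2 : ℤ) ∣ h₂)) {b : ℕ}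
    (hb : 2 ≤ b) :
    ((Finset.range (2 ^ b)).filter (fun y : ℕ => Nat.Coprime y 2 ∧
      (2 : ℤ) ^ b ∣ 2 * h₁ + 3 * h₂ * y)).card ≤ 2 := by
  obtain ⟨e, rfl⟩ : ∃ e, b = e + 1 := ⟨b - 1, by omega⟩
  have he : e ≠ 0 := by omega
  by_cases hh₂ : (2 : ℤ) ∣ h₂
  · have hh₁ : ¬ (2 : ℤ) ∣ h₁ := fun h => hnot ⟨h, hh₂⟩
    obtain ⟨h₂', rfl⟩ := hh₂
    -- the predicate is `2ᵉ`-periodic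
    have hP : ∀ y z : ℕ, (Nat.Coprime (y + 2 ^ e * z) 2 ∧
        (2 : ℤ) ^ (e + 1) ∣ 2 * h₁ + 3 * (2 * h₂') * ((y + 2 ^ e * z : ℕ) : ℤ)) ↔
        (Nat.Coprime y 2 ∧ (2 : ℤ) ^ (e + 1) ∣ 2 * h₁ + 3 * (2 * h₂') * (y : ℤ)) := by
      intro y z
      rw [coprime_add_pow_mul_iff he]
      refine and_congr_right (fun _ => ?_)
      rw [show 2 * h₁ + 3 * (2 * h₂') * ((y + 2 ^ e * z : ℕ) : ℤ) =
          (2 : ℤ) ^ (e + 1) * (3 * h₂' * z) + (2 * h₁ + 3 * (2 * h₂') * (y : ℤ)) by push_cast; ring]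
      exact dvd_add_right (dvd_mul_right _ _)
    -- one class modulo `2ᵉ`
    have hcardA : ((Finset.range (2 ^ e)).filter (fun y : ℕ => Nat.Coprime y 2 ∧
        (2 : ℤ) ^ (e + 1) ∣ 2 * h₁ + 3 * (2 * h₂') * y)).card ≤ 1 := by
      refine card_filter_le_one_of_linear Nat.prime_two (L := h₁) (K := 3 * h₂')
        (fun h => hh₁ (by exact_mod_cast h.1)) e _ (fun u hu => ?_)
      have h := hu.2
      rw [pow_succ, show 2 * h₁ + 3 * (2 * h₂') * (u : ℤ) = (h₁ + 3 * h₂' * u) * 2 by ring] at h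
      exact_mod_cast (mul_dvd_mul_iff_right (by norm_num : (2 : ℤ) ≠ 0)).mp h
    rw [Finset.card_eq_sum_ones, show Finset.range (2 ^ (e + 1)) = Finset.range (2 ^ e * 2) by
        rw [pow_succ], sum_filter_range_mul (fun _ => 1) (2 ^ e) 2 _ hP]
    simp only [Finset.sum_const, Finset.card_range, smul_eq_mul, mul_one]
    omega
  · -- `h₂` odd: no critical point at all
    have hempty : (Finset.range (2 ^ (e + 1))).filter (fun y : ℕ => Nat.Coprime y 2 ∧
        (2 : ℤ) ^ (e + 1) ∣ 2 * h₁ + 3 * h₂ * y) = ∅ := by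
      refine Finset.filter_false_of_mem (fun y _ h => ?_)
      obtain ⟨hcop, hdiv⟩ := h
      have h2 : (2 : ℤ) ∣ 2 * h₁ + 3 * h₂ * y := (dvd_pow_self 2 (Nat.succ_ne_zero e)).trans hdiv
      have h3 : (2 : ℤ) ∣ 3 * h₂ * y := (dvd_add_right (dvd_mul_right 2 h₁)).mp h2
      rcases Int.prime_two.dvd_or_dvd h3 with h4 | h4
      · rcases Int.prime_two.dvd_or_dvd h4 with h5 | h5
        · norm_num at h5
        · exact hh₂ h5
      · have h6 : (2 : ℕ) ∣ y := by exact_mod_cast h4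
        exact (Nat.Prime.coprime_iff_not_dvd Nat.prime_two).mp (Nat.coprime_comm.mp hcop) h6
    rw [hempty, Finset.card_empty]
    exact Nat.zero_le _

/-- **Odd exponent, at most one critical point at `p = 2`.** For `(h₁, h₂)` not both even and `a ≥ 1`, at most one
odd `y < 2ᵃ` satisfies `2^{a+1} ∣ g(y)`, `g(y) = y(2h₁ + 3h₂y) + 2ᵃ(h₁ + 3h₂y)`: for odd `y`,
`y(L + Ky) = g(y) + 2ᵃh₁(y² - 1) ≡ g(y) (mod 2^{a+1})` with `L = 2h₁ + 3·2ᵃh₂`, `K = 3h₂ + 2ᵃh₁`, so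
`2^{a+1} ∣ L + Ky`; if `h₂` is odd, `K` is odd (one class mod `2^{a+1}`), and if `h₂ = 2h₂′` (`h₁` odd) then
`2ᵃ ∣ L/2 + (K/2)y` with `L/2 = h₁ + 3·2ᵃh₂′` odd (one class mod `2ᵃ`); either way `card_filter_le_one_of_linear`
applies. [folklore] -/
theorem card_critical_two_le_one {h₁ h₂ : ℤ} (hnot : ¬ ((2 : ℤ) ∣ h₁ ∧ (2 : ℤ) ∣ h₂)) {a : ℕ} (ha : a ≠ 0) :
    ((Finset.range (2 ^ a)).filter (fun y : ℕ => Nat.Coprime y 2 ∧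
      (2 : ℤ) ^ (a + 1) ∣ y * (2 * h₁ + 3 * h₂ * y) + 2 ^ a * (h₁ + 3 * h₂ * y))).card ≤ 1 := by
  -- uniform linearisation along odd `u`
  have hlin : ∀ u : ℕ, Nat.Coprime u 2 →
      (2 : ℤ) ^ (a + 1) ∣ u * (2 * h₁ + 3 * h₂ * u) + 2 ^ a * (h₁ + 3 * h₂ * u) →
      (2 : ℤ) ^ (a + 1) ∣ (2 * h₁ + 3 * 2 ^ a * h₂) + (3 * h₂ + 2 ^ a * h₁) * u := by
    intro u hu hdiv
    obtain ⟨k, hk⟩ : Odd u := Nat.coprime_two_right.mp hu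
    have hcop : IsCoprime ((2 : ℤ) ^ (a + 1)) (u : ℤ) := by
      have h1 : Nat.Coprime (2 ^ (a + 1)) u := Nat.Coprime.pow_left _ (Nat.coprime_comm.mp hu)
      exact_mod_cast Nat.isCoprime_iff_coprime.mpr h1
    refine hcop.dvd_of_dvd_mul_left ?_
    have hsq : (u : ℤ) * ((2 * h₁ + 3 * 2 ^ a * h₂) + (3 * h₂ + 2 ^ a * h₁) * u) =
        (u * (2 * h₁ + 3 * h₂ * u) + 2 ^ a * (h₁ + 3 * h₂ * u)) +
          2 ^ (a + 1) * (h₁ * (2 * k ^ 2 + 2 * k)) := by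
      subst hk
      push_cast
      ring
    rw [hsq]
    exact dvd_add hdiv (dvd_mul_right _ _)
  by_cases hh₂ : (2 : ℤ) ∣ h₂
  · -- `h₂ = 2h₂'`, `h₁` odd: halve the linear form
    have hh₁ : ¬ (2 : ℤ) ∣ h₁ := fun h => hnot ⟨h, hh₂⟩
    obtain ⟨h₂', rfl⟩ := hh₂
    obtain ⟨a', rfl⟩ : ∃ a', a = a' + 1 := ⟨a - 1, by omega⟩
    refine card_filter_le_one_of_linear Nat.prime_two (L := h₁ + 3 * 2 ^ (a' + 1) * h₂')
      (K := 3 * h₂' + 2 ^ a' * h₁) (fun h => hh₁ ?_) (a' + 1) _ (fun u hu => ?_)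
    · have hL : (2 : ℤ) ∣ h₁ + 3 * 2 ^ (a' + 1) * h₂' := by exact_mod_cast h.1
      have h2 : (2 : ℤ) ∣ 3 * 2 ^ (a' + 1) * h₂' := ⟨3 * 2 ^ a' * h₂', by ring⟩
      exact (dvd_add_left h2).mp hL
    · have h := hlin u hu.1 hu.2
      rw [pow_succ, show (2 * h₁ + 3 * 2 ^ (a' + 1) * (2 * h₂')) + (3 * (2 * h₂') + 2 ^ (a' + 1) * h₁) * (u : ℤ)
          = ((h₁ + 3 * 2 ^ (a' + 1) * h₂') + (3 * h₂' + 2 ^ a' * h₁) * u) * 2 by ring] at h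
      exact_mod_cast (mul_dvd_mul_iff_right (by norm_num : (2 : ℤ) ≠ 0)).mp h
  · -- `h₂` odd: `K` is odd, one class even modulo `2^{a+1}`
    have hsub : (Finset.range (2 ^ a)).filter (fun y : ℕ => Nat.Coprime y 2 ∧
          (2 : ℤ) ^ (a + 1) ∣ y * (2 * h₁ + 3 * h₂ * y) + 2 ^ a * (h₁ + 3 * h₂ * y)) ⊆
        (Finset.range (2 ^ (a + 1))).filter (fun y : ℕ => Nat.Coprime y 2 ∧
          (2 : ℤ) ^ (a + 1) ∣ y * (2 * h₁ + 3 * h₂ * y) + 2 ^ a * (h₁ + 3 * h₂ * y)) :=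
      Finset.filter_subset_filter _
        (Finset.range_subset_range.mpr (Nat.pow_le_pow_right (by norm_num) (by omega)))
    refine (Finset.card_le_card hsub).trans ?_
    refine card_filter_le_one_of_linear Nat.prime_two (L := 2 * h₁ + 3 * 2 ^ a * h₂)
      (K := 3 * h₂ + 2 ^ a * h₁) (fun h => hh₂ ?_) (a + 1) _ (fun u hu => by exact_mod_cast hlin u hu.1 hu.2)
    have hK : (2 : ℤ) ∣ 3 * h₂ + 2 ^ a * h₁ := by exact_mod_cast h.2
    have h2 : (2 : ℤ) ∣ 2 ^ a * h₁ := dvd_mul_of_dvd_left (dvd_pow_self 2 ha) _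
    rcases Int.prime_two.dvd_or_dvd ((dvd_add_left h2).mp hK) with h3 | h3
    · norm_num at h3
    · exact h3

/-! ## B. The prime `p = 2`: the first step for odd exponents, and the bound -/

/-- **First step at `p = 2`, odd exponent `n = 2a+1`, `a ≥ 1`.** Substituting `t = y + 2ᵃz` (`y < 2ᵃ`, `z < 2^{a+1}`):
`f(y + 2ᵃz) = f(y) + 2ᵃz f′(y) + 2^{2a}z²(h₁ + 3h₂y) + 2^{3a}z³h₂ ≡ f(y) + 2ᵃ z g(y) (mod 2^{2a+1})` with
`g(y) = y(2h₁ + 3h₂y) + 2ᵃ(h₁ + 3h₂y)`, because `z² ≡ z (mod 2)` and `3a ≥ 2a + 1`; orthogonality in `z` then gives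
`S = 2^{a+1} · Σ_{odd y < 2ᵃ, 2^{a+1} ∣ g(y)} e(f(y)/2ⁿ)`. (Iwaniec–Kowalski 2004, §12.3, adapted to `p = 2`.) -/
theorem cuspSum_firstStep_two_odd (h₁ h₂ : ℤ) {a : ℕ} (ha : a ≠ 0) :
    ∑ t ∈ (Finset.range (2 ^ (a + (a + 1)))).filter (fun t : ℕ => Nat.Coprime t 2),
        ZMod.stdAddChar (N := 2 ^ (a + (a + 1))) ((h₁ * t ^ 2 + h₂ * t ^ 3 : ℤ) : ZMod (2 ^ (a + (a + 1))))
      = (2 : ℂ) ^ (a + 1) * ∑ y ∈ (Finset.range (2 ^ a)).filter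
          (fun y : ℕ => Nat.Coprime y 2 ∧
            (2 : ℤ) ^ (a + 1) ∣ y * (2 * h₁ + 3 * h₂ * y) + 2 ^ a * (h₁ + 3 * h₂ * y)),
            ZMod.stdAddChar (N := 2 ^ (a + (a + 1))) ((h₁ * y ^ 2 + h₂ * y ^ 3 : ℤ) : ZMod (2 ^ (a + (a + 1)))) := by
  -- adapted from `cuspSum_firstStep_three_odd` (file 1/2) and `DeepModuli.cuspSum_firstStep`
  classical
  obtain ⟨a', rfl⟩ : ∃ a', a = a' + 1 := ⟨a - 1, by omega⟩
  -- pointwise splitting of the summand after the substitution `t = y + 2ᵃ z`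
  have hsplit : ∀ y z : ℕ,
      ZMod.stdAddChar (N := 2 ^ (a' + 1 + (a' + 1 + 1)))
          ((h₁ * ((y + 2 ^ (a' + 1) * z : ℕ) : ℤ) ^ 2 + h₂ * ((y + 2 ^ (a' + 1) * z : ℕ) : ℤ) ^ 3 : ℤ) :
            ZMod (2 ^ (a' + 1 + (a' + 1 + 1))))
        = ZMod.stdAddChar (N := 2 ^ (a' + 1 + (a' + 1 + 1)))
            ((h₁ * y ^ 2 + h₂ * y ^ 3 : ℤ) : ZMod (2 ^ (a' + 1 + (a' + 1 + 1)))) *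
          ZMod.stdAddChar (N := 2 ^ (a' + 1 + 1))
            ((z * (y * (2 * h₁ + 3 * h₂ * y) + 2 ^ (a' + 1) * (h₁ + 3 * h₂ * y)) : ℤ) :
              ZMod (2 ^ (a' + 1 + 1))) := by
    intro y z
    have hsc : ZMod.stdAddChar (N := 2 ^ (a' + 1 + (a' + 1 + 1)))
        (((2 ^ (a' + 1) : ℕ) * (z * (y * (2 * h₁ + 3 * h₂ * y) + 2 ^ (a' + 1) * (h₁ + 3 * h₂ * y))) : ℤ) :
          ZMod (2 ^ (a' + 1 + (a' + 1 + 1))))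
        = ZMod.stdAddChar (N := 2 ^ (a' + 1 + 1))
            ((z * (y * (2 * h₁ + 3 * h₂ * y) + 2 ^ (a' + 1) * (h₁ + 3 * h₂ * y)) : ℤ) :
              ZMod (2 ^ (a' + 1 + 1))) :=
      stdAddChar_mul_eq (by ring) _
    obtain ⟨q, hq⟩ := two_dvd_sq_sub z
    rw [← hsc, ← AddChar.map_add_eq_mul, ← Int.cast_add]
    congr 1
    rw [ZMod.intCast_eq_intCast_iff_dvd_sub]
    refine ⟨-(q * (h₁ + 3 * h₂ * y) + 2 ^ a' * z ^ 3 * h₂), ?_⟩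
    push_cast
    linear_combination (-(2 : ℤ) ^ (2 * a' + 2) * (h₁ + 3 * h₂ * y)) * hq
  simp only [Finset.sum_filter]
  rw [Finset.mul_sum, show Finset.range (2 ^ (a' + 1 + (a' + 1 + 1))) =
      Finset.range (2 ^ (a' + 1) * 2 ^ (a' + 1 + 1)) by rw [← pow_add],
    sum_range_mul_eq_sum_sum _ (2 ^ (a' + 1)) (2 ^ (a' + 1 + 1))]
  refine Finset.sum_congr rfl (fun y _ => ?_)
  simp only [coprime_add_pow_mul_iff (Nat.succ_ne_zero a'), hsplit]
  by_cases hy : Nat.Coprime y 2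
  · simp only [if_pos hy]
    rw [← Finset.mul_sum, sum_range_stdAddChar_mul (2 ^ (a' + 1 + 1))
      (y * (2 * h₁ + 3 * h₂ * y) + 2 ^ (a' + 1) * (h₁ + 3 * h₂ * y))]
    have hdvd : ((2 ^ (a' + 1 + 1) : ℕ) : ℤ) ∣ y * (2 * h₁ + 3 * h₂ * y) + 2 ^ (a' + 1) * (h₁ + 3 * h₂ * y) ↔
        (2 : ℤ) ^ (a' + 1 + 1) ∣ y * (2 * h₁ + 3 * h₂ * y) + 2 ^ (a' + 1) * (h₁ + 3 * h₂ * y) := by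
      push_cast
      exact Iff.rfl
    by_cases hL : (2 : ℤ) ^ (a' + 1 + 1) ∣ y * (2 * h₁ + 3 * h₂ * y) + 2 ^ (a' + 1) * (h₁ + 3 * h₂ * y)
    · rw [if_pos (hdvd.mpr hL), if_pos ⟨hy, hL⟩, mul_comm]
      push_cast
      ring
    · rw [if_neg (mt hdvd.mp hL), if_neg (fun h => hL h.2), mul_zero, mul_zero]
  · simp only [hy, false_and, if_false, Finset.sum_const_zero, mul_zero]

/-- **The cusp sum at `p = 2`.** For `n ≥ 2` and `(h₁, h₂)` not both even, `|S(h₁,h₂;2ⁿ)| ≤ 2·2^{n/2}`: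
for even `n = 2b` by the first step with `a = b` (`DeepModuli.cuspSum_firstStep`) and the count
`card_critical_two_even_le_two` (`n = 2`: trivial bound `φ(4) = 2`); for odd `n = 2a+1` by `cuspSum_firstStep_two_odd`
and the count `card_critical_two_le_one`, giving `|S| ≤ 2^{a+1} = √2·2^{n/2}`. -/
theorem norm_cuspSum_two_le {n : ℕ} (hn : 2 ≤ n) (h₁ h₂ : ℤ) (hnot : ¬ ((2 : ℤ) ∣ h₁ ∧ (2 : ℤ) ∣ h₂)) :
    ‖∑ t ∈ (Finset.range (2 ^ n)).filter (fun t : ℕ => Nat.Coprime t 2),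
        ZMod.stdAddChar (N := 2 ^ n) ((h₁ * t ^ 2 + h₂ * t ^ 3 : ℤ) : ZMod (2 ^ n))‖
      ≤ 2 * (2 : ℝ) ^ ((n : ℝ) / 2) := by
  rcases Nat.even_or_odd' n with ⟨a, rfl | rfl⟩
  · -- even exponent `n = 2a`
    have hexp : (2 : ℝ) ^ (((2 * a : ℕ) : ℝ) / 2) = (2 : ℝ) ^ a := by
      rw [show ((2 * a : ℕ) : ℝ) / 2 = (a : ℝ) by push_cast; ring, Real.rpow_natCast]
    rw [hexp]
    rcases Nat.lt_or_ge a 2 with ha2 | ha2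
    · -- `n = 2`: trivial bound
      obtain rfl : a = 1 := by omega
      refine (norm_sum_stdAddChar_le_card _ _).trans ?_
      rw [card_filter_coprime_prime_pow Nat.prime_two (by norm_num)]
      norm_num
    obtain ⟨e, rfl⟩ : ∃ e, a = e + 2 := ⟨a - 2, by omega⟩
    have hfirst := cuspSum_firstStep (p := 2) h₁ h₂ (a := e + 2) (b := e + 2) le_rfl (by omega)
    simp only [Nat.cast_ofNat] at hfirst
    rw [show 2 * (e + 2) = e + 2 + (e + 2) by ring, hfirst, norm_mul, norm_pow, Complex.norm_ofNat]
    have hcard := card_critical_two_even_le_two hnot (b := e + 2) (by omega)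
    have hT := norm_sum_stdAddChar_le_card ((Finset.range (2 ^ (e + 2))).filter (fun y : ℕ => Nat.Coprime y 2 ∧
        (2 : ℤ) ^ (e + 2) ∣ 2 * h₁ + 3 * h₂ * y))
      (fun y : ℕ => ((h₁ * y ^ 2 + h₂ * y ^ 3 : ℤ) : ZMod (2 ^ (e + 2 + (e + 2)))))
    have h2 : (((Finset.range (2 ^ (e + 2))).filter (fun y : ℕ => Nat.Coprime y 2 ∧
        (2 : ℤ) ^ (e + 2) ∣ 2 * h₁ + 3 * h₂ * y)).card : ℝ) ≤ 2 := by
      exact_mod_cast hcard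
    have hpos : (0 : ℝ) ≤ (2 : ℝ) ^ (e + 2) := by positivity
    nlinarith [mul_le_mul_of_nonneg_left (hT.trans h2) hpos]
  · -- odd exponent `n = 2a + 1`
    have ha : a ≠ 0 := by omega
    rw [show 2 * a + 1 = a + (a + 1) by ring, cuspSum_firstStep_two_odd h₁ h₂ ha, norm_mul, norm_pow,
      Complex.norm_ofNat]
    have hmono : (2 : ℝ) ^ (a : ℝ) ≤ (2 : ℝ) ^ (((a + (a + 1) : ℕ) : ℝ) / 2) :=
      Real.rpow_le_rpow_of_exponent_le (by norm_num) (by push_cast; linarith)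
    rw [Real.rpow_natCast] at hmono
    have hcard := card_critical_two_le_one hnot ha
    have hT := norm_sum_stdAddChar_le_card ((Finset.range (2 ^ a)).filter (fun y : ℕ => Nat.Coprime y 2 ∧
        (2 : ℤ) ^ (a + 1) ∣ y * (2 * h₁ + 3 * h₂ * y) + 2 ^ a * (h₁ + 3 * h₂ * y)))
      (fun y : ℕ => ((h₁ * y ^ 2 + h₂ * y ^ 3 : ℤ) : ZMod (2 ^ (a + (a + 1)))))
    have h1 : (((Finset.range (2 ^ a)).filter (fun y : ℕ => Nat.Coprime y 2 ∧
        (2 : ℤ) ^ (a + 1) ∣ y * (2 * h₁ + 3 * h₂ * y) + 2 ^ a * (h₁ + 3 * h₂ * y))).card : ℝ) ≤ 1 := by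
      exact_mod_cast hcard
    have hpos : (0 : ℝ) ≤ (2 : ℝ) ^ a := by positivity
    rw [pow_succ]
    nlinarith [mul_le_mul_of_nonneg_left (hT.trans h1) hpos, hmono]

/-! ## C. The registered stub -/

/-- **STUB `stub_cuspStationaryPhase23`** of the line `deep-moduli-cusp-dispersion` (crux stmt-ABC-1975, statement
`CuspSumBound23`, verbatim): for `p` prime with `p < 5` (i.e. `p ∈ {2, 3}`), `n ≥ 2` and `(h₁, h₂)` not both divisible
by `p`, the complete cusp sum satisfies `|S(h₁,h₂;pⁿ)| ≤ 2·p^{n/2}`. Proof: rewrite the summand as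
`ZMod.stdAddChar (N := pⁿ)` of `h₁t² + h₂t³` (`ZMod.stdAddChar_coe`), then `p = 2` is `norm_cuspSum_two_le` (this file)
and `p = 3` is `cuspSumBound23_three_main` (file 1/2). (Iwaniec–Kowalski 2004, §12.3, adapted to `p = 2, 3`.) -/
theorem stub_cuspStationaryPhase23 : ∀ p n : ℕ, p.Prime → p < 5 → 2 ≤ n → ∀ h₁ h₂ : ℤ, ¬ ((p : ℤ) ∣ h₁ ∧ (p : ℤ) ∣ h₂) → ‖∑ t ∈ (Finset.range (p ^ n)).filter (fun t : ℕ => Nat.Coprime t p), Complex.exp (2 * (Real.pi : ℂ) * Complex.I * ((h₁ : ℂ) * (t : ℂ) ^ 2 + (h₂ : ℂ) * (t : ℂ) ^ 3) / (p : ℂ) ^ n)‖ ≤ 2 * (p : ℝ) ^ ((n : ℝ) / 2) := by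
  intro p n hp hp5 hn h₁ h₂ hnot
  haveI := Fact.mk hp
  -- adapted from `DeepModuli.stub_cuspStationaryPhase`: the bridge `Complex.exp` ↔ `ZMod.stdAddChar`
  have hsummand : ∀ t : ℕ, Complex.exp (2 * (Real.pi : ℂ) * Complex.I *
      ((h₁ : ℂ) * (t : ℂ) ^ 2 + (h₂ : ℂ) * (t : ℂ) ^ 3) / (p : ℂ) ^ n)
      = ZMod.stdAddChar (N := p ^ n) ((h₁ * t ^ 2 + h₂ * t ^ 3 : ℤ) : ZMod (p ^ n)) := by
    intro t
    rw [ZMod.stdAddChar_coe]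
    push_cast
    ring_nf
  rw [Finset.sum_congr rfl (fun t _ => hsummand t)]
  have hp2 := hp.two_le
  interval_cases p
  · simp only [Nat.cast_ofNat] at hnot ⊢
    exact norm_cuspSum_two_le hn h₁ h₂ hnot
  · simp only [Nat.cast_ofNat] at hnot ⊢
    exact cuspSumBound23_three_main n hn h₁ h₂ hnot
  · exact absurd hp (by norm_num)

end Summit.ABC.ABC.Theorems.SharpModerateLaw.CuspDispersion

end
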